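import Mathlib.SetTheory.Ordinal.Rank
import Mathlib.RingTheory.Ideal.Quotient.Operations
import Mathlib.RingTheory.Ideal.Quotient.Noetherian
import Mathlib.RingTheory.PrincipalIdealDomain
import Mathlib.RingTheory.UniqueFactorizationDomain.NormalizedFactors
import Literature.Algebra.EuclideanDomain.EuclideanOrderTypeLimitOrdinal
import HarnessLib

/-!
# The ordinal length function `λ_R` of a Noetherian ring: `len(R/I) = λ_R(I)`, `ℓ(x) ≤ φ_R(x)` transfinitely, and
# `ℓ(π₁⋯πₙ) = n`, `ℓ(0) = len(R) = ω` for a PID (Clark 2015, §3.1, Props. 29–30)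

Topic `Literature/Algebra/EuclideanDomain`, namespace `Literature.Algebra.EuclideanDomain`.  THEOREMS ONLY (no `def`, no
instance, no named fact), all proved.  Clark's ORDINAL-valued length `λ_R : 𝓘^∨(R) → Ord` of a Noetherian ring — the least
isotone map on the dual (Artinian) lattice of ideals, after Gulliksen and Brookfield — is Mathlib's rank for the relation `>`
on `Ideal R`: `λ_R(I) = IsWellFounded.rank (· > ·) I` («the smallest ordinal greater than the ranks of all elements below it»
in `𝓘^∨(R)`, i.e. of all ideals strictly above `I`), and `ℓ(x) = λ_R((x))`.  `LengthVersusEuclideanFunction.lean` proved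
Props. 29–30 with Mathlib's `ℕ∞`-valued `Module.length` (so `len(R) = ⊤`); here they are proved for the ordinal length as
printed (`len(R) = ω`), and Prop. 29 in its transfinite form `ℓ(x) ≤ φ_R(x) = θ(x) − 1`, `ℓ(0) = len(R) ≤ e(R)`.

## Source (read at the page)

P. L. Clark, *A note on Euclidean order types*, Order **32** (2015) 157–178 [Clark2015EuclideanOrderTypes] (materialised
`paper:arxiv-1208.0977`, arXiv numbering; `p0008.txt`), §3.1, VERBATIM.  «Let `R` be a ring, and let `𝓘(R)` be the lattice
of ideals of `R`.  Then `𝓘(R)` is Noetherian (resp. Artinian) iff `R` is Noetherian (resp. Artinian).  Thus the dual lattice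
`𝓘^∨(R)` is Artinian (resp. Noetherian) iff `R` is Noetherian (resp. Artinian).  Henceforth we suppose `R` is Noetherian, so
`𝓘^∨(R)` is Artinian with top element `(0)`.  By the results of §1 there is a least isotone map `λ_R : 𝓘^∨(R) → Ord`, the
length function `λ_R` of `R`, and we define the length of `R` as `len(R) = λ_R((0))`.  For any ideal `I` of `R`, `R/I` is
Noetherian … the usual pullback of ideals `q^*` identifies `𝓘(R/I)` with an ordered subset of `𝓘(R)` … and it is easy to see
that under this identification we have `λ_R|_{𝓘^∨(R/I)} = λ_{R/I}`, and thus also `len(R/I) = λ_{R/I}((0)) = λ_R(q^*((0))) =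
λ_R(I)`.  To ease notation, for `x ∈ R` we put `ℓ(x) = λ_R((x))`.  **Proposition 29.** Let `φ` be a Euclidean function on
`R`.  For all `x ∈ R`, `ℓ(x) ≤ φ(x)`.  Proof. Since `R` admits a Euclidean function, it is a principal ring … We may assume
that `φ = φ_R` is the bottom Euclidean function on `R`. … `ℓ = λ_R` is the least isotone function on `𝓘^∨(R)`, so
`ℓ(x) ≤ φ_R(x)` for all `x ∈ R`.  If `R` is a PID and `x ∈ R•`, then the ring `R/(x)` is an Artinian ring and thus its length,
which is equal to `ℓ(x)`, is finite.  In particular, for all `x ∈ R•` `ℓ(x) < ω` and `ℓ(0) = ω`. … **Proposition 30.** Let `R`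
be a PID which is not a field, and let `x ∈ R`.  a) If `x ∈ R^×`, then `ℓ(x) = 0`.  b) If `x ∈ R• ∖ R^×`, we may write
`x = π₁ ⋯ πₙ` for not necessarily distinct prime elements `π₁, …, πₙ`, and then `ℓ(x) = n`.  c) We have `ℓ(0) = len(R) = ω`.»
(The bottom Euclidean function: `φ_R(x) = θ(x) − 1` for `x ≠ 0` and `φ_R(0) = sup_{x≠0} φ_R(x) + 1`, Clark §2.1/§2.5; in the
tree `θ = samuelRank`, `e(R) = ⨆ z, ((θ z − 1) + 1)`.)

## What is formalised

* §1 (`R` Noetherian, `λ_R = IsWellFounded.rank (· > ·)` on `Ideal R`): `rank_gt_top` (`λ_R(R) = 0`, Prop. 30 (a):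
  `ℓ(u) = 0` for a unit, `rank_gt_span_singleton_eq_zero_of_isUnit`), **`rank_gt_comap_quotient_mk`** /
  **`rank_gt_bot_quotient`** («`λ_R|_{𝓘^∨(R/I)} = λ_{R/I}`», «`len(R/I) = λ_R(I)`»).
* §2 **Prop. 29, transfinite**, for a principal ideal ring exhausted by its transfinite construction:
  **`rank_gt_span_singleton_le_samuelRank_sub_one`** (`ℓ(x) ≤ φ_R(x) = θ(x) − 1`, `x ≠ 0`), `rank_gt_bot_le_iSup_samuelRank`
  (`ℓ(0) = len(R) ≤ φ_R(0) = e(R)`), `rank_gt_span_singleton_le_of_algorithm` (`ℓ(x) ≤ φ(x)` for every ordinal-valued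
  algorithm `φ`, through `θ ≤ φ`), and the `EuclideanDomain` instances of the first two.
* §3 **Prop. 30 for a PID**: `rank_gt_span_singleton_eq_card_normalizedFactors` (`ℓ(x) = Ω(x)`),
  **`rank_gt_span_singleton_unit_mul_multiset_prod`** ((b) as printed: `ℓ(u·π₁⋯πₙ) = n`), `rank_gt_span_singleton_lt_omega0`
  («for all `x ∈ R•`, `ℓ(x) < ω`»), **`rank_gt_bot_eq_omega0`** ((c): `ℓ(0) = len(R) = ω` for a PID which is not a field).

## Mathlib / tree search

Mathlib: `IsWellFounded.rank`, `IsWellFounded.rank_eq`, `IsWellFounded.rank_lt_of_rel`, the instance `IsNoetherian → WellFoundedGT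
(Submodule R M)`, `Ideal.comap_map_of_surjective`, `Ideal.map_comap_of_surjective`, `Ideal.comap_mono`, `Ideal.map_mono`,
`Ideal.mk_ker`, `Submodule.IsPrincipal`, `Ideal.span_singleton_le_span_singleton`, `Ideal.mem_span_singleton`,
`UniqueFactorizationMonoid.normalizedFactors_mul`, `…dvd_iff_normalizedFactors_le_normalizedFactors`,
`…associated_iff_normalizedFactors_eq_normalizedFactors`, `…normalizedFactors_irreducible`, `UniqueFactorizationMonoid.strongNormalizationMonoid`,
`Multiset.card_lt_card`, `Ordinal.omega0_le`, `Ordinal.iSup_le`, `Ordinal.le_iSup`.  Tree: `EuclideanOrderTypeLimitOrdinal.lean`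
(`samuelRank_sub_one_add_one_le_of_dvd`), `EuclideanOrderTypeIndecomposable.lean` (`samuelRank_sub_one_lt_iSup`),
`TransfiniteSmallestAlgorithm.lean` (`samuelRank_le_of_algorithm`), `EuclideanDomainIffTransfiniteConstruction.lean`
(`forall_exists_mem_samuelSet_of_euclideanDomain`), `LengthVersusEuclideanFunction.lean` (the `ℕ∞` versions);
`rg "IsWellFounded.rank" Literature` → only `Literature/Order/Ordinal/BrookfieldLengthFunction.lean` (the abstract `λ_X`).
-/

namespace Literature.Algebra.EuclideanDomain

open Ordinal Order

universe u

variable {R : Type u} [CommRing R]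

/-! ## §1 `λ_R` on a Noetherian ring: `λ_R(R) = 0`, `len(R/I) = λ_R(I)` -/

section Noetherian

variable [IsNoetherianRing R]

/-- `λ_R(R) = 0`: the unit ideal is the bottom of `𝓘^∨(R)`. [cite: Clark2015EuclideanOrderTypes, §3.1 and Prop. 30 (a)] -/
theorem rank_gt_top : IsWellFounded.rank (α := Ideal R) (· > ·) ⊤ = 0 := by
  rw [IsWellFounded.rank_eq]
  haveI : IsEmpty {J : Ideal R // J > ⊤} := ⟨fun J ↦ not_top_lt J.2⟩
  exact Ordinal.iSup_eq_zero_iff.2 fun J ↦ isEmptyElim J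

/-- **Prop. 30 (a) «if `x ∈ R^×`, then `ℓ(x) = 0`»** (in any Noetherian ring). [cite: Clark2015EuclideanOrderTypes, Prop. 30 (a)] -/
theorem rank_gt_span_singleton_eq_zero_of_isUnit {u : R} (hu : IsUnit u) :
    IsWellFounded.rank (α := Ideal R) (· > ·) (Ideal.span {u}) = 0 := by
  rw [Ideal.span_singleton_eq_top.2 hu, rank_gt_top]

/-- **«`λ_R|_{𝓘^∨(R/I)} = λ_{R/I}`»**: the length function of `R/I` is that of `R` on the pulled-back ideals.
[cite: Clark2015EuclideanOrderTypes, §3.1] -/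
theorem rank_gt_comap_quotient_mk (I : Ideal R) (J : Ideal (R ⧸ I)) :
    IsWellFounded.rank (α := Ideal (R ⧸ I)) (· > ·) J =
      IsWellFounded.rank (α := Ideal R) (· > ·) (J.comap (Ideal.Quotient.mk I)) := by
  have hs : Function.Surjective (Ideal.Quotient.mk I) := Ideal.Quotient.mk_surjective
  -- the pullback `q^*` is strictly isotone and its image is the set of ideals above `I`
  have hcm : ∀ K : Ideal R, I ≤ K → (K.map (Ideal.Quotient.mk I)).comap (Ideal.Quotient.mk I) = K := fun K hK ↦ by
    rw [Ideal.comap_map_of_surjective _ hs, ← RingHom.ker_eq_comap_bot, Ideal.mk_ker, sup_eq_left.2 hK]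
  induction J using WellFoundedGT.induction with
  | ind J ih =>
    rw [IsWellFounded.rank_eq, IsWellFounded.rank_eq]
    apply le_antisymm
    · refine Ordinal.iSup_le fun K ↦ ?_
      rw [ih K.1 K.2]
      have hlt : J.comap (Ideal.Quotient.mk I) < K.1.comap (Ideal.Quotient.mk I) :=
        lt_of_le_of_ne (Ideal.comap_mono K.2.le) fun h ↦ K.2.ne (Ideal.comap_injective_of_surjective _ hs h)
      exact Ordinal.le_iSup (fun L : {L : Ideal R // L > J.comap (Ideal.Quotient.mk I)} ↦
        succ (IsWellFounded.rank (· > ·) L.1)) ⟨_, hlt⟩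
    · refine Ordinal.iSup_le fun L ↦ ?_
      have hIL : I ≤ L.1 := (Ideal.mk_ker (I := I)).symm.trans_le
        ((RingHom.ker_eq_comap_bot _).trans_le ((Ideal.comap_mono bot_le).trans L.2.le))
      have hlt : J < L.1.map (Ideal.Quotient.mk I) := by
        refine lt_of_le_of_ne ?_ fun h ↦ L.2.ne ((congr_arg (Ideal.comap (Ideal.Quotient.mk I)) h).trans (hcm L.1 hIL))
        calc J = (J.comap (Ideal.Quotient.mk I)).map (Ideal.Quotient.mk I) := (Ideal.map_comap_of_surjective _ hs J).symm
          _ ≤ L.1.map (Ideal.Quotient.mk I) := Ideal.map_mono L.2.le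
      rw [← hcm L.1 hIL, ← ih _ hlt]
      exact Ordinal.le_iSup (fun K : {K : Ideal (R ⧸ I) // K > J} ↦ succ (IsWellFounded.rank (· > ·) K.1)) ⟨_, hlt⟩

/-- **«`len(R/I) = λ_{R/I}((0)) = λ_R(q^*((0))) = λ_R(I)`»**. [cite: Clark2015EuclideanOrderTypes, §3.1] -/
theorem rank_gt_bot_quotient (I : Ideal R) :
    IsWellFounded.rank (α := Ideal (R ⧸ I)) (· > ·) ⊥ = IsWellFounded.rank (α := Ideal R) (· > ·) I := by
  rw [rank_gt_comap_quotient_mk, ← RingHom.ker_eq_comap_bot, Ideal.mk_ker]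

end Noetherian

/-! ## §2 Prop. 29, transfinite: `ℓ(x) ≤ φ_R(x) = θ(x) − 1` and `len(R) ≤ e(R)` -/

section PropTwentyNine

variable [IsPrincipalIdealRing R]

/-- In a principal ideal ring an ideal strictly above `(x)` is `(y)` with `y ∣ x`, `(x) ≠ (y)`, `y ≠ 0` (for `x ≠ 0`).
[cite: Clark2015EuclideanOrderTypes, proof of Prop. 29 («`𝓘^∨(R) = R•/R^×`»)] -/
theorem exists_eq_span_singleton_of_span_singleton_lt {x : R} (hx0 : x ≠ 0) {K : Ideal R} (hK : Ideal.span {x} < K) :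
    ∃ y : R, K = Ideal.span {y} ∧ y ∣ x ∧ Ideal.span {x} ≠ Ideal.span {y} ∧ y ≠ 0 := by
  obtain ⟨y, hy⟩ : ∃ y : R, K = Ideal.span {y} := ⟨_, (Ideal.span_singleton_generator K).symm⟩
  rw [hy] at hK
  refine ⟨y, hy, Ideal.span_singleton_le_span_singleton.1 hK.le, hK.ne, fun h0 ↦ hx0 ?_⟩
  have hx : x ∈ Ideal.span {y} := hK.le (Ideal.mem_span_singleton_self x)
  rw [h0, Ideal.span_singleton_zero, Ideal.mem_bot] at hx
  exact hx

/-- **Prop. 29, transfinite form «`ℓ(x) ≤ φ_R(x)`»**: for a principal ideal ring exhausted by its transfinite construction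
and `x ≠ 0`, `λ_R((x)) ≤ θ(x) − 1` (induction up the divisors: `(y) ⊋ (x)` forces `(θ(y) − 1) + 1 ≤ θ(x) − 1`).
[cite: Clark2015EuclideanOrderTypes, Prop. 29] -/
theorem rank_gt_span_singleton_le_samuelRank_sub_one (h : ∀ z : R, ∃ α : Ordinal.{u}, z ∈ samuelSet R α) {x : R}
    (hx0 : x ≠ 0) : IsWellFounded.rank (α := Ideal R) (· > ·) (Ideal.span {x}) ≤ samuelRank x - 1 := by
  suffices H : ∀ I : Ideal R, ∀ x : R, x ≠ 0 → I = Ideal.span {x} →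
      IsWellFounded.rank (α := Ideal R) (· > ·) I ≤ samuelRank x - 1 from H _ x hx0 rfl
  intro I
  induction I using WellFoundedGT.induction with
  | ind I ih =>
    intro x hx0 hI
    subst hI
    rw [IsWellFounded.rank_eq]
    refine Ordinal.iSup_le fun K ↦ ?_
    obtain ⟨y, hKy, hyx, hne, hy0⟩ := exists_eq_span_singleton_of_span_singleton_lt hx0 K.2
    calc succ (IsWellFounded.rank (· > ·) K.1) ≤ succ (samuelRank y - 1) :=
          succ_le_succ (ih K.1 K.2 y hy0 hKy)
      _ = samuelRank y - 1 + 1 := (succ_eq_add_one _)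
      _ ≤ samuelRank x - 1 := samuelRank_sub_one_add_one_le_of_dvd h hyx hne hy0 hx0

/-- **«`ℓ(0) = len(R) = λ_R((0))`» is at most `φ_R(0) = sup_{x≠0} φ_R(x) + 1 = e(R)`** (Prop. 29 at `x = 0`).
[cite: Clark2015EuclideanOrderTypes, Prop. 29 and §2.5] -/
theorem rank_gt_bot_le_iSup_samuelRank (h : ∀ z : R, ∃ α : Ordinal.{u}, z ∈ samuelSet R α) :
    IsWellFounded.rank (α := Ideal R) (· > ·) ⊥ ≤ ⨆ z : R, (samuelRank z - 1 + 1) := by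
  rw [IsWellFounded.rank_eq]
  refine Ordinal.iSup_le fun K ↦ ?_
  obtain ⟨y, hy⟩ : ∃ y : R, K.1 = Ideal.span {y} := ⟨_, (Ideal.span_singleton_generator K.1).symm⟩
  have hy0 : y ≠ 0 := by
    rintro rfl
    rw [Ideal.span_singleton_zero] at hy
    exact K.2.ne' hy
  rw [hy]
  calc succ (IsWellFounded.rank (α := Ideal R) (· > ·) (Ideal.span {y})) ≤ succ (samuelRank y - 1) :=
        succ_le_succ (rank_gt_span_singleton_le_samuelRank_sub_one h hy0)
    _ ≤ _ := succ_le_of_lt (samuelRank_sub_one_lt_iSup y)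

/-- **Prop. 29 «for all `x ∈ R`, `ℓ(x) ≤ φ(x)`»** for every ordinal-valued Euclidean function (algorithm) `φ` on a principal
ideal ring and `x ≠ 0`: `ℓ(x) ≤ θ(x) − 1 ≤ θ(x) ≤ φ(x)` (`θ` is the smallest algorithm). [cite: Clark2015EuclideanOrderTypes,
Prop. 29] -/
theorem rank_gt_span_singleton_le_of_algorithm (φ : R → Ordinal.{u})
    (hφ : ∀ a b : R, b ≠ 0 → ∃ q r : R, a = b * q + r ∧ φ r < φ b) {x : R} (hx0 : x ≠ 0) :
    IsWellFounded.rank (α := Ideal R) (· > ·) (Ideal.span {x}) ≤ φ x :=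
  ((rank_gt_span_singleton_le_samuelRank_sub_one (exists_mem_samuelSet_of_algorithm φ hφ) hx0).trans
    (Ordinal.sub_le_self _ _)).trans (samuelRank_le_of_algorithm φ hφ id strictMono_id x)

end PropTwentyNine

/-- Prop. 29 for a Euclidean domain (Mathlib's `EuclideanDomain`): `ℓ(x) ≤ θ(x) − 1` for `x ≠ 0`.
[cite: Clark2015EuclideanOrderTypes, Prop. 29] -/
theorem rank_gt_span_singleton_le_samuelRank_sub_one_of_euclideanDomain {R : Type u} [EuclideanDomain R] {x : R}
    (hx0 : x ≠ 0) : IsWellFounded.rank (α := Ideal R) (· > ·) (Ideal.span {x}) ≤ samuelRank x - 1 :=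
  rank_gt_span_singleton_le_samuelRank_sub_one forall_exists_mem_samuelSet_of_euclideanDomain hx0

/-- Prop. 29 at `0` for a Euclidean domain: `len(R) ≤ e(R)`. [cite: Clark2015EuclideanOrderTypes, Prop. 29] -/
theorem rank_gt_bot_le_iSup_samuelRank_of_euclideanDomain {R : Type u} [EuclideanDomain R] :
    IsWellFounded.rank (α := Ideal R) (· > ·) ⊥ ≤ ⨆ z : R, (samuelRank z - 1 + 1) :=
  rank_gt_bot_le_iSup_samuelRank forall_exists_mem_samuelSet_of_euclideanDomain

/-! ## §3 Prop. 30: `ℓ` on a PID -/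

section PID

variable [IsDomain R] [IsPrincipalIdealRing R]

/-- Strict divisibility strictly increases the number of prime factors (private helper). [folklore] -/
private theorem card_normalizedFactors_lt_of_dvd [NormalizationMonoid R] {x y : R} (hx0 : x ≠ 0) (hy0 : y ≠ 0)
    (hyx : y ∣ x) (hxy : ¬ x ∣ y) :
    Multiset.card (UniqueFactorizationMonoid.normalizedFactors y) <
      Multiset.card (UniqueFactorizationMonoid.normalizedFactors x) := by
  refine Multiset.card_lt_card (lt_of_le_of_ne
    ((UniqueFactorizationMonoid.dvd_iff_normalizedFactors_le_normalizedFactors hy0 hx0).1 hyx) fun heq ↦ hxy ?_)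
  exact ((UniqueFactorizationMonoid.associated_iff_normalizedFactors_eq_normalizedFactors hy0 hx0).2 heq).symm.dvd

/-- **`ℓ(x) = Ω(x)`**, the number of prime factors counted with multiplicity, for `x ≠ 0` in a PID (with any normalisation).
[cite: Clark2015EuclideanOrderTypes, Prop. 30 (b)] -/
theorem rank_gt_span_singleton_eq_card_normalizedFactors [NormalizationMonoid R] {x : R} (hx0 : x ≠ 0) :
    IsWellFounded.rank (α := Ideal R) (· > ·) (Ideal.span {x}) =
      (Multiset.card (UniqueFactorizationMonoid.normalizedFactors x) : Ordinal.{u}) := by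
  suffices H : ∀ n : ℕ, ∀ x : R, x ≠ 0 → Multiset.card (UniqueFactorizationMonoid.normalizedFactors x) = n →
      IsWellFounded.rank (α := Ideal R) (· > ·) (Ideal.span {x}) = n from H _ x hx0 rfl
  intro n
  induction n using Nat.strong_induction_on with
  | _ n ih =>
    intro x hx0 hn
    rw [IsWellFounded.rank_eq]
    apply le_antisymm
    · refine Ordinal.iSup_le fun K ↦ ?_
      obtain ⟨y, hKy, hyx, hne, hy0⟩ := exists_eq_span_singleton_of_span_singleton_lt hx0 K.2
      have hxy : ¬ x ∣ y := fun hxy ↦ hne (le_antisymm (hKy ▸ K.2.le) (Ideal.span_singleton_le_span_singleton.2 hxy))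
      have hlt := card_normalizedFactors_lt_of_dvd hx0 hy0 hyx hxy
      rw [hn] at hlt
      rw [hKy, ih _ hlt y hy0 rfl]
      exact succ_le_of_lt (Nat.cast_lt.2 hlt)
    · rcases n.eq_zero_or_pos with rfl | hpos
      · rw [Nat.cast_zero]; exact bot_le
      · -- `x` is a non-unit: `x = p·y` with `p` prime, `(y) ⊋ (x)` and `Ω(y) = n − 1`
        have hxu : ¬ IsUnit x := fun hxu ↦ by
          rw [(UniqueFactorizationMonoid.normalizedFactors_eq_zero_iff hx0).2 hxu, Multiset.card_zero] at hn
          omega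
        obtain ⟨p, hp⟩ := UniqueFactorizationMonoid.exists_mem_normalizedFactors hx0 hxu
        have hpx : p ∣ x := UniqueFactorizationMonoid.dvd_of_mem_normalizedFactors hp
        obtain ⟨y, rfl⟩ := hpx
        have hp' : Prime p := UniqueFactorizationMonoid.prime_of_normalized_factor p hp
        have hp0 : p ≠ 0 := hp'.ne_zero
        have hy0 : y ≠ 0 := right_ne_zero_of_mul hx0
        have hcard : Multiset.card (UniqueFactorizationMonoid.normalizedFactors y) + 1 = n := by
          rw [← hn, UniqueFactorizationMonoid.normalizedFactors_mul hp0 hy0,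
            UniqueFactorizationMonoid.normalizedFactors_irreducible hp'.irreducible, Multiset.card_add,
            Multiset.card_singleton, add_comm]
        have hlt : Ideal.span {p * y} < Ideal.span {y} := by
          refine lt_of_le_of_ne (Ideal.span_singleton_le_span_singleton.2 (Dvd.intro_left p rfl)) fun heq ↦ hp'.not_unit ?_
          obtain ⟨c, hc⟩ : p * y ∣ y := Ideal.span_singleton_le_span_singleton.1 heq.ge
          exact IsUnit.of_mul_eq_one c (mul_right_cancel₀ hy0 (by rw [mul_assoc, mul_comm c, ← mul_assoc, ← hc, one_mul]))
        have hyn : Multiset.card (UniqueFactorizationMonoid.normalizedFactors y) < n := by omega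
        calc ((n : ℕ) : Ordinal.{u}) = succ ((Multiset.card (UniqueFactorizationMonoid.normalizedFactors y) : ℕ) : Ordinal) := by
              rw [succ_eq_add_one, ← Nat.cast_add_one, hcard]
          _ = succ (IsWellFounded.rank (α := Ideal R) (· > ·) (Ideal.span {y})) := by rw [ih _ hyn y hy0 rfl]
          _ ≤ _ := Ordinal.le_iSup (fun K : {K : Ideal R // K > Ideal.span {p * y}} ↦
              succ (IsWellFounded.rank (· > ·) K.1)) ⟨_, hlt⟩

/-- **Prop. 30 (b) as printed**: «if `x ∈ R• ∖ R^×`, we may write `x = π₁ ⋯ πₙ` for not necessarily distinct prime elements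
`π₁, …, πₙ`, and then `ℓ(x) = n`» — for any unit `u` and multiset `s` of primes, `ℓ(u · ∏ s) = |s|`.
[cite: Clark2015EuclideanOrderTypes, Prop. 30 (b)] -/
theorem rank_gt_span_singleton_unit_mul_multiset_prod (s : Multiset R) (hs : ∀ p ∈ s, Prime p) {u : R} (hu : IsUnit u) :
    IsWellFounded.rank (α := Ideal R) (· > ·) (Ideal.span {u * s.prod}) = (Multiset.card s : Ordinal.{u}) := by
  letI : StrongNormalizationMonoid R := UniqueFactorizationMonoid.strongNormalizationMonoid
  have hs0 : s.prod ≠ 0 := Multiset.prod_ne_zero fun h0 ↦ (hs 0 h0).ne_zero rfl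
  have hcard : ∀ t : Multiset R, (∀ p ∈ t, Prime p) →
      Multiset.card (UniqueFactorizationMonoid.normalizedFactors t.prod) = Multiset.card t := by
    intro t
    induction t using Multiset.induction_on with
    | empty => intro; simp [UniqueFactorizationMonoid.normalizedFactors_one]
    | cons p t ih =>
      intro ht
      have hp : Prime p := ht p (Multiset.mem_cons_self p t)
      have ht' : ∀ q ∈ t, Prime q := fun q hq ↦ ht q (Multiset.mem_cons_of_mem hq)
      have ht0 : t.prod ≠ 0 := Multiset.prod_ne_zero fun h0 ↦ (ht' 0 h0).ne_zero rfl
      rw [Multiset.prod_cons, UniqueFactorizationMonoid.normalizedFactors_mul hp.ne_zero ht0,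
        UniqueFactorizationMonoid.normalizedFactors_irreducible hp.irreducible, Multiset.card_add, Multiset.card_singleton,
        ih ht', Multiset.card_cons, add_comm]
  rw [Ideal.span_singleton_mul_left_unit hu, rank_gt_span_singleton_eq_card_normalizedFactors hs0, hcard s hs]

/-- **«for all `x ∈ R•`, `ℓ(x) < ω`»** in a PID. [cite: Clark2015EuclideanOrderTypes, §3.1 (before Prop. 30)] -/
theorem rank_gt_span_singleton_lt_omega0 {x : R} (hx0 : x ≠ 0) :
    IsWellFounded.rank (α := Ideal R) (· > ·) (Ideal.span {x}) < ω := by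
  letI : StrongNormalizationMonoid R := UniqueFactorizationMonoid.strongNormalizationMonoid
  rw [rank_gt_span_singleton_eq_card_normalizedFactors hx0]
  exact natCast_lt_omega0 _

/-- **Prop. 30 (c) «`ℓ(0) = len(R) = ω`»** for a PID which is not a field: every non-zero ideal has finite length, and the powers
of a non-unit have unbounded lengths. [cite: Clark2015EuclideanOrderTypes, Prop. 30 (c)] -/
theorem rank_gt_bot_eq_omega0 (hR : ¬ IsField R) : IsWellFounded.rank (α := Ideal R) (· > ·) ⊥ = ω := by
  letI : StrongNormalizationMonoid R := UniqueFactorizationMonoid.strongNormalizationMonoid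
  apply le_antisymm
  · rw [IsWellFounded.rank_eq]
    refine Ordinal.iSup_le fun K ↦ ?_
    obtain ⟨y, hy⟩ : ∃ y : R, K.1 = Ideal.span {y} := ⟨_, (Ideal.span_singleton_generator K.1).symm⟩
    have hy0 : y ≠ 0 := by
      rintro rfl
      rw [Ideal.span_singleton_zero] at hy
      exact K.2.ne' hy
    rw [hy]
    exact succ_le_of_lt (rank_gt_span_singleton_lt_omega0 hy0)
  · obtain ⟨p, hp0, hpu⟩ : ∃ p : R, p ≠ 0 ∧ ¬ IsUnit p := by
      by_contra hne
      push Not at hne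
      exact hR ⟨exists_pair_ne R, mul_comm, fun ha ↦ (hne _ ha).exists_right_inv⟩
    refine omega0_le.2 fun n ↦ ?_
    have hpn0 : p ^ n ≠ 0 := pow_ne_zero n hp0
    -- `Ω(pⁿ) ≥ n`, so `λ_R((pⁿ)) ≥ n`, and `(pⁿ) ≠ (0)` lies strictly below `(0)` in `𝓘^∨(R)`
    have hle : (n : Ordinal.{u}) ≤ IsWellFounded.rank (α := Ideal R) (· > ·) (Ideal.span {p ^ n}) := by
      rw [rank_gt_span_singleton_eq_card_normalizedFactors hpn0, UniqueFactorizationMonoid.normalizedFactors_pow,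
        Multiset.card_nsmul, Nat.cast_le]
      have h1 : 1 ≤ Multiset.card (UniqueFactorizationMonoid.normalizedFactors p) :=
        Multiset.card_pos.2 ((UniqueFactorizationMonoid.normalizedFactors_pos p hp0).2 hpu).ne'
      calc n = n * 1 := (mul_one n).symm
        _ ≤ n * Multiset.card (UniqueFactorizationMonoid.normalizedFactors p) := Nat.mul_le_mul_left n h1
    exact hle.trans (IsWellFounded.rank_lt_of_rel (r := (· > ·))
      (bot_lt_iff_ne_bot.2 ((Ideal.span_singleton_eq_bot.not).2 hpn0))).le

/-- Prop. 30 (c) with §3.1: `len(R) = len(R/(0)) = ℓ(0) = ω` read in the quotient `R/(0)`. [cite: Clark2015EuclideanOrderTypes,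
Prop. 30 (c) and §3.1] -/
theorem rank_gt_bot_quotient_span_zero_eq_omega0 (hR : ¬ IsField R) :
    IsWellFounded.rank (α := Ideal (R ⧸ Ideal.span {(0 : R)})) (· > ·) ⊥ = ω := by
  rw [rank_gt_bot_quotient (Ideal.span {(0 : R)}), Ideal.span_singleton_zero, rank_gt_bot_eq_omega0 hR]

end PID

end Literature.Algebra.EuclideanDomain
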